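import Literature.Analysis.FluidPDE.NSRegFourierSolution
import Literature.Analysis.FluidPDE.NSFourierPlancherel
import HarnessLib

/-!
# Energy of the regularised solution: Plancherel and the energy equality

Tenth file of the Fourier-side construction of the global regular solution of the
Leray-regularised Navier–Stokes system (discharge of
`Literature.Analysis.FluidPDE.leray_regularised_wellposed`). For the classical solution `u = Re 𝓕 V`
of `NSRegFourierSolution` (`RegSetup`), Plancherel (`NSFourierPlancherel`) transports the
Fourier-side quantities of `NSRegFourierMild` to physical space:

* `memLp_u`, `eLpNorm_u_sub_le` — `u(t) ∈ L²` and `‖u(t') − u(t)‖_{L²} ≤ card ι ‖V(t') − V(t)‖_{L²}`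
  (so `u ∈ C([0,T]; L²)` from the `L²` continuity of `V`);
* `integral_norm_sq_u` — `∫ ‖u(t)‖² = ∫ ∑ₗ ‖V(t,ξ)ₗ‖² dξ`;
* `integral_frobeniusNormSq_fderiv_u` — `∫ |∇u(t)|² = 4π² ∫ ‖ξ‖² ∑ₗ ‖V(t,ξ)ₗ‖² dξ`;
* `energyEq` — **Leray's energy equality for the regularised system**
  `½‖u(t)‖₂² + ν ∫ₛᵗ∫ |∇u|² = ½‖u(s)‖₂²` (`0 ≤ s ≤ t ≤ T`), the physical-space form of
  `IsRegMild.energy_eq` (Leray 1934, (3.4) p. 220 with §26 p. 237, "W(t) … ne croît pas";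
  Ożański–Pooley 2018, (6.80)), and the finiteness of the dissipation.

## References

* J. Leray, Acta Math. 63 (1934), §17 (3.4), Ch. V §26. [Leray1934]
* W. S. Ożański, B. C. Pooley, LMS Lecture Note Ser. 452 (2018), Thm. 6.33, (6.80). [OzanskiPooley2018]
* E. M. Stein, G. Weiss, *Introduction to Fourier Analysis on Euclidean Spaces* (1971), Ch. I Thm. 2.3.
-/

noncomputable section

open MeasureTheory Real Set Filter Topology Function Complex FourierTransform InnerProductSpace
open scoped FourierTransform RealInnerProductSpace ENNReal ComplexConjugate

namespace Literature.Analysis.FluidPDE.FourierNS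

open ClayDatum (reVec reVec_apply inner_eq_sum')

variable {ι : Type*} [Fintype ι] [DecidableEq ι]

namespace RegSetup

variable (d : RegSetup ι)

/-! ### Square integrability of the coefficient slices -/

/-- Components of `V(t)` are square integrable (`t ∈ [0, T]`). [folklore] -/
theorem memLp_V {t : ℝ} (_ht : t ∈ Icc 0 d.T) (l : ι) : MemLp (fun ξ => d.V t ξ l) 2 volume :=
  ((d.mildK 0).memLp t).eval l

/-- Weighted components `-2πi ξ_j V(t)ₗ` are integrable and square integrable (`t ∈ [0, T]`). [folklore] -/
theorem memLp_coord_mul_V {t : ℝ} (ht : t ∈ Icc 0 d.T) (j l : ι) :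
    Integrable (fun ξ : EuclideanSpace ℝ ι => (-(2 * π * I) * ((ξ j : ℝ) : ℂ)) * d.V t ξ l) volume ∧
    MemLp (fun ξ : EuclideanSpace ℝ ι => (-(2 * π * I) * ((ξ j : ℝ) : ℂ)) * d.V t ξ l) 2 volume := by
  refine ⟨integrable_twoPiI_coord_mul (d.aesm_V t l) (d.integrable_pow_mul_norm 1 ht l) j, ?_⟩
  -- `‖ξ_j V_l‖ ≤ (1 + ‖ξ‖) ‖V‖ = ‖wfun 1 V ξ‖`, square integrable by weight-`1` mildness
  have hw : MemLp (wfun 1 (d.V t)) 2 volume :=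
    ⟨aestronglyMeasurable_wfun 1 (d.measurable_V t).aestronglyMeasurable, (d.mildK 1).eLpNorm_wfun_lt_top t⟩
  refine ⟨(Continuous.aestronglyMeasurable (by fun_prop)).mul (d.aesm_V t l), ?_⟩
  refine lt_of_le_of_lt (eLpNorm_mono fun ξ => ?_) ((hw.const_smul (2 * π : ℝ)).eLpNorm_lt_top)
  rw [norm_mul, norm_mul, norm_neg, norm_mul, norm_mul, Complex.norm_two, Complex.norm_real, Complex.norm_I, mul_one,
    Real.norm_eq_abs, abs_of_pos Real.pi_pos, Complex.norm_real, Real.norm_eq_abs, Pi.smul_apply, norm_smul,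
    Real.norm_of_nonneg (by positivity : (0:ℝ) ≤ 2 * π), norm_wfun, pow_one]
  calc 2 * π * |ξ j| * ‖d.V t ξ l‖ ≤ 2 * π * ‖ξ‖ * ‖d.V t ξ‖ :=
        mul_le_mul (by gcongr; exact abs_apply_le_norm ξ j) (norm_le_pi_norm _ l) (norm_nonneg _) (by positivity)
    _ ≤ 2 * π * ((1 + ‖ξ‖) * ‖d.V t ξ‖) := by nlinarith [norm_nonneg ξ, norm_nonneg (d.V t ξ), Real.pi_pos]

/-! ### The velocity in `L²` -/

/-- Complex velocity components are square integrable, with `‖U(t)ₗ‖_{L²} = ‖V(t)ₗ‖_{L²}`. [folklore] -/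
theorem memLp_U {t : ℝ} (ht : t ∈ Icc 0 d.T) (l : ι) :
    MemLp (fun x => d.U t x l) 2 volume ∧ eLpNorm (fun x => d.U t x l) 2 volume = eLpNorm (fun ξ => d.V t ξ l) 2 volume :=
  ⟨memLp_two_fourierIntegral (d.integrable_V ht l) (d.memLp_V ht l),
    eLpNorm_fourierIntegral_eq (d.integrable_V ht l) (d.memLp_V ht l)⟩

/-- The velocity slices are a.e.-strongly measurable (indeed continuous). [folklore] -/
theorem continuous_u {t : ℝ} (ht : t ∈ Icc 0 d.T) : Continuous (d.u t) := by
  have h := d.smooth_u.continuousOn.comp_continuous (f := fun x : EuclideanSpace ℝ ι => ((t, x) : ℝ × EuclideanSpace ℝ ι))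
    (continuous_const.prodMk continuous_id) fun x => mk_mem_prod ht (mem_univ x)
  simpa only [Function.comp_def, Function.uncurry_apply_pair] using h

/-- **`u(t) ∈ L²`** with `‖u(t)‖_{L²} ≤ ∑ₗ ‖V(t)ₗ‖_{L²}`. [folklore] -/
theorem memLp_u {t : ℝ} (ht : t ∈ Icc 0 d.T) : MemLp (d.u t) 2 volume := by
  have hcomp : ∀ l, MemLp (fun x => d.u t x l) 2 volume := fun l => by
    have h := (d.memLp_U ht l).1
    have : (fun x => d.u t x l) = fun x => (d.U t x l).re := rfl
    rw [this]
    exact ⟨Complex.continuous_re.comp_aestronglyMeasurable h.1,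
      lt_of_le_of_lt (eLpNorm_mono fun x => by simpa using Complex.abs_re_le_norm (d.U t x l)) h.2⟩
  refine (memLp_two_iff_integrable_sq_norm (d.continuous_u ht).aestronglyMeasurable).2 ?_
  have heq : (fun x => ‖d.u t x‖ ^ 2) = fun x => ∑ l, (fun x => d.u t x l) x ^ 2 := by
    funext x
    rw [EuclideanSpace.norm_sq_eq]
    refine Finset.sum_congr rfl fun l _ => ?_
    rw [Real.norm_eq_abs, sq_abs]
  rw [heq]
  exact integrable_finsetSum _ fun l _ => (hcomp l).integrable_sq

/-! ### Generic conversions -/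

omit [DecidableEq ι] in
/-- `∫ ‖f‖² = (‖f‖²_{L²}).toReal` for `f ∈ L²`. [folklore] -/
theorem integral_norm_sq_eq_toReal {α : Type*} [MeasurableSpace α] {μ : Measure α} {F : Type*} [NormedAddCommGroup F]
    {f : α → F} (hf : MemLp f 2 μ) : ∫ x, ‖f x‖ ^ 2 ∂μ = (eLpNorm f 2 μ ^ 2).toReal := by
  rw [← lintegral_enorm_sq_eq_eLpNorm_sq, integral_eq_lintegral_of_nonneg_ae (Eventually.of_forall fun x => by positivity)
    ((hf.1.norm.aemeasurable.pow_const 2).aestronglyMeasurable)]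
  congr 1
  refine lintegral_congr_ae (Eventually.of_forall fun x => ?_)
  show ENNReal.ofReal (‖f x‖ ^ 2) = ‖f x‖ₑ ^ 2
  rw [← ofReal_norm, ENNReal.ofReal_pow (norm_nonneg _)]

omit [DecidableEq ι] in
/-- The squared extended norm of a Euclidean vector is the sum of the squared extended norms of
its coordinates. [folklore] -/
theorem enorm_sq_euclidean (x : EuclideanSpace ℝ ι) : ‖x‖ₑ ^ 2 = ∑ l, ‖x l‖ₑ ^ 2 := by
  rw [← ofReal_norm, ← ENNReal.ofReal_pow (norm_nonneg _), EuclideanSpace.norm_sq_eq,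
    ENNReal.ofReal_sum_of_nonneg fun l _ => by positivity]
  refine Finset.sum_congr rfl fun l _ => ?_
  rw [← ofReal_norm, ENNReal.ofReal_pow (norm_nonneg _)]

/-! ### `L²` distances of velocity slices -/

/-- **`‖u(t') − u(t)‖²_{L²} ≤ card ι · ‖V(t') − V(t)‖²_{L²}`** for `t, t' ∈ [0, T]` (coordinates,
`|Re z| ≤ |z|`, Plancherel for differences, coordinate norm against the sup norm). [folklore] -/
theorem eLpNorm_u_sub_sq_le {t t' : ℝ} (ht : t ∈ Icc 0 d.T) (ht' : t' ∈ Icc 0 d.T) :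
    eLpNorm (d.u t' - d.u t) 2 volume ^ 2 ≤ (Fintype.card ι : ℝ≥0∞) * eLpNorm (d.V t' - d.V t) 2 volume ^ 2 := by
  -- coordinates
  have h1 : eLpNorm (d.u t' - d.u t) 2 volume ^ 2 = ∑ l, ∫⁻ x, ‖d.u t' x l - d.u t x l‖ₑ ^ 2 := by
    rw [← lintegral_enorm_sq_eq_eLpNorm_sq]
    have : ∀ x, ‖(d.u t' - d.u t) x‖ₑ ^ 2 = ∑ l, ‖d.u t' x l - d.u t x l‖ₑ ^ 2 := fun x => by
      rw [Pi.sub_apply, enorm_sq_euclidean]; rfl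
    simp_rw [this]
    rw [lintegral_finsetSum _ fun l _ => ?_]
    exact (((continuous_apply l).comp (PiLp.continuous_ofLp 2 _) |>.comp (d.continuous_u ht')).sub
      ((continuous_apply l).comp (PiLp.continuous_ofLp 2 _) |>.comp (d.continuous_u ht))).measurable.enorm.pow_const 2
  -- each coordinate against the complex components, then Plancherel
  have h2 : ∀ l, ∫⁻ x, ‖d.u t' x l - d.u t x l‖ₑ ^ 2 ≤ eLpNorm (fun ξ => d.V t' ξ l - d.V t ξ l) 2 volume ^ 2 := by
    intro l
    have hP := eLpNorm_fourierIntegral_sub_eq (d.integrable_V ht' l) (d.memLp_V ht' l) (d.integrable_V ht l) (d.memLp_V ht l)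
    rw [← show eLpNorm ((𝓕 fun ξ => d.V t' ξ l) - 𝓕 fun ξ => d.V t ξ l) 2 volume ^ 2 =
        eLpNorm (fun ξ => d.V t' ξ l - d.V t ξ l) 2 volume ^ 2 by rw [hP]; rfl, ← lintegral_enorm_sq_eq_eLpNorm_sq]
    refine lintegral_mono fun x => ?_
    gcongr
    rw [u_apply, u_apply, ← Complex.sub_re, ← ofReal_norm, ← ofReal_norm]
    refine ENNReal.ofReal_le_ofReal ?_
    rw [Real.norm_eq_abs]
    exact Complex.abs_re_le_norm (d.U t' x l - d.U t x l)
  -- coordinates of `V` against the sup norm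
  have h3 : ∀ l, eLpNorm (fun ξ => d.V t' ξ l - d.V t ξ l) 2 volume ^ 2 ≤ eLpNorm (d.V t' - d.V t) 2 volume ^ 2 := by
    intro l
    gcongr
    refine eLpNorm_mono fun ξ => ?_
    exact norm_le_pi_norm (d.V t' ξ - d.V t ξ) l
  calc eLpNorm (d.u t' - d.u t) 2 volume ^ 2 = ∑ l, ∫⁻ x, ‖d.u t' x l - d.u t x l‖ₑ ^ 2 := h1
    _ ≤ ∑ _l : ι, eLpNorm (d.V t' - d.V t) 2 volume ^ 2 := Finset.sum_le_sum fun l _ => (h2 l).trans (h3 l)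
    _ = (Fintype.card ι : ℝ≥0∞) * eLpNorm (d.V t' - d.V t) 2 volume ^ 2 := by
        rw [Finset.sum_const, Finset.card_univ, nsmul_eq_mul]

/-- **`∫ ‖u(t)‖² = ∫ ∑ₗ ‖V(t,ξ)ₗ‖² dξ`** (coordinates, reality and Plancherel). [folklore] -/
theorem integral_norm_sq_u {t : ℝ} (ht : t ∈ Icc 0 d.T) : ∫ x, ‖d.u t x‖ ^ 2 = ∫ ξ, ∑ l, ‖d.V t ξ l‖ ^ 2 := by
  have hcoord : ∀ x, ‖d.u t x‖ ^ 2 = ∑ l, ‖d.U t x l‖ ^ 2 := fun x => by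
    rw [EuclideanSpace.norm_sq_eq]
    refine Finset.sum_congr rfl fun l _ => ?_
    rw [← d.ofReal_u_apply, Complex.norm_real]
  simp_rw [hcoord]
  have hU2 : ∀ l, Integrable (fun x => ‖d.U t x l‖ ^ 2) volume := fun l =>
    IsRegMild.integrable_normSq_of_memLp (d.memLp_U ht l).1
  have hV2 : ∀ l, Integrable (fun ξ => ‖d.V t ξ l‖ ^ 2) volume := fun l =>
    IsRegMild.integrable_normSq_of_memLp (d.memLp_V ht l)
  rw [integral_finsetSum _ fun l _ => hU2 l, integral_finsetSum _ fun l _ => hV2 l]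
  refine Finset.sum_congr rfl fun l _ => ?_
  rw [integral_norm_sq_eq_toReal (d.memLp_U ht l).1, integral_norm_sq_eq_toReal (d.memLp_V ht l), (d.memLp_U ht l).2]

/-- **The kinetic energy on the Fourier side**: `½∫‖u(t)‖² = ½ ∫ ∑ₗ ‖V(t,ξ)ₗ‖² dξ`. [folklore] -/
theorem kineticEnergy_u {t : ℝ} (ht : t ∈ Icc 0 d.T) :
    VectorCalculus.kineticEnergy (d.u t) = 2⁻¹ * ∫ ξ, ∑ l, ‖d.V t ξ l‖ ^ 2 := by
  rw [VectorCalculus.kineticEnergy, d.integral_norm_sq_u ht]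

/-! ### The dissipation on the Fourier side -/

/-- The symbol of `∂ⱼ uₗ`: `g_{jl}(ξ) = -2πi ξⱼ V(t,ξ)ₗ`. [folklore] -/
def gsym (t : ℝ) (j l : ι) (ξ : EuclideanSpace ℝ ι) : ℂ := (-(2 * π * I) * ((ξ j : ℝ) : ℂ)) * d.V t ξ l

/-- Conjugation symmetry of `g_{jl}`. [folklore] -/
theorem gsym_conj (t : ℝ) (j l : ι) (ξ : EuclideanSpace ℝ ι) : d.gsym t j l (-ξ) = conj (d.gsym t j l ξ) := by
  simp only [gsym, PiLp.neg_apply, Complex.ofReal_neg, map_mul, map_neg, Complex.conj_ofReal, d.V_conj,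
    Complex.conj_I, map_ofNat]
  ring

/-- `‖g_{jl}(ξ)‖² = 4π² ξⱼ² ‖V(t,ξ)ₗ‖²`. [folklore] -/
theorem norm_gsym_sq (t : ℝ) (j l : ι) (ξ : EuclideanSpace ℝ ι) :
    ‖d.gsym t j l ξ‖ ^ 2 = 4 * π ^ 2 * ((ξ j) ^ 2 * ‖d.V t ξ l‖ ^ 2) := by
  rw [gsym, norm_mul, norm_mul, norm_neg, norm_mul, norm_mul, Complex.norm_two, Complex.norm_real, Complex.norm_I, mul_one,
    Real.norm_eq_abs, abs_of_pos Real.pi_pos, Complex.norm_real, Real.norm_eq_abs, mul_pow, mul_pow, sq_abs]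
  ring

/-- **`∂ⱼ uₗ = Re 𝓕 g_{jl}`**, and `𝓕 g_{jl}` is real. [folklore] -/
theorem fderiv_u_basisFun {t : ℝ} (ht : t ∈ Icc 0 d.T) (x : EuclideanSpace ℝ ι) (j l : ι) :
    fderiv ℝ (d.u t) x (EuclideanSpace.basisFun ι ℝ j) l = (𝓕 (d.gsym t j l) x).re ∧
      𝓕 (d.gsym t j l) x = (((𝓕 (d.gsym t j l) x).re : ℝ) : ℂ) := by
  refine ⟨?_, fourier_eq_re_of_conj_symm (d.gsym_conj t j l) x⟩
  rw [d.fderiv_u_apply ht]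
  have hfun : (fun ξ : EuclideanSpace ℝ ι => (-(2 * π * I) * (⟪ξ, (EuclideanSpace.basisFun ι ℝ) j⟫ : ℂ)) * d.V t ξ l) =
      d.gsym t j l := by
    funext ξ
    rw [EuclideanSpace.basisFun_apply, EuclideanSpace.inner_single_right]
    simp [gsym]
  rw [hfun]

/-- **The pointwise dissipation density on the Fourier side**:
`|∇u(t, x)|² = ∑ⱼ ∑ₗ ‖𝓕 g_{jl} (x)‖²`. [folklore] -/
theorem frobeniusNormSq_fderiv_u {t : ℝ} (ht : t ∈ Icc 0 d.T) (x : EuclideanSpace ℝ ι) :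
    frobeniusNormSq (fderiv ℝ (d.u t) x) = ∑ j, ∑ l, ‖𝓕 (d.gsym t j l) x‖ ^ 2 := by
  rw [frobeniusNormSq_eq_sum (EuclideanSpace.basisFun ι ℝ)]
  refine Finset.sum_congr rfl fun j _ => ?_
  rw [EuclideanSpace.norm_sq_eq]
  refine Finset.sum_congr rfl fun l _ => ?_
  obtain ⟨h1, h2⟩ := d.fderiv_u_basisFun ht x j l
  rw [show (fderiv ℝ (d.u t) x ((EuclideanSpace.basisFun ι ℝ) j)).ofLp l = fderiv ℝ (d.u t) x (EuclideanSpace.basisFun ι ℝ j) l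
    from rfl, h1]
  conv_rhs => rw [h2]
  rw [Complex.norm_real]

/-- The symbols `g_{jl}` are integrable and square integrable, with Plancherel. [folklore] -/
theorem memLp_gsym {t : ℝ} (ht : t ∈ Icc 0 d.T) (j l : ι) :
    Integrable (d.gsym t j l) volume ∧ MemLp (d.gsym t j l) 2 volume ∧ MemLp (𝓕 (d.gsym t j l)) 2 volume ∧
      eLpNorm (𝓕 (d.gsym t j l)) 2 volume = eLpNorm (d.gsym t j l) 2 volume := by
  obtain ⟨h1, h2⟩ := d.memLp_coord_mul_V ht j l
  exact ⟨h1, h2, memLp_two_fourierIntegral h1 h2, eLpNorm_fourierIntegral_eq h1 h2⟩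

/-- **The dissipation on the Fourier side**: `x ↦ |∇u(t,x)|²` is integrable and
`∫ |∇u(t)|² = 4π² ∫ ‖ξ‖² ∑ₗ ‖V(t,ξ)ₗ‖² dξ` (Plancherel for each `g_{jl}` and `∑ⱼ ξⱼ² = ‖ξ‖²`). [folklore] -/
theorem integral_frobeniusNormSq_fderiv_u {t : ℝ} (ht : t ∈ Icc 0 d.T) :
    Integrable (fun x => frobeniusNormSq (fderiv ℝ (d.u t) x)) volume ∧
      ∫ x, frobeniusNormSq (fderiv ℝ (d.u t) x) = 4 * π ^ 2 * ∫ ξ : EuclideanSpace ℝ ι, ‖ξ‖ ^ 2 * ∑ l, ‖d.V t ξ l‖ ^ 2 := by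
  have hF2 : ∀ j l, Integrable (fun x => ‖𝓕 (d.gsym t j l) x‖ ^ 2) volume := fun j l =>
    IsRegMild.integrable_normSq_of_memLp (d.memLp_gsym ht j l).2.2.1
  have hg2 : ∀ j l, Integrable (fun ξ => ‖d.gsym t j l ξ‖ ^ 2) volume := fun j l =>
    IsRegMild.integrable_normSq_of_memLp (d.memLp_gsym ht j l).2.1
  have heq : (fun x => frobeniusNormSq (fderiv ℝ (d.u t) x)) = fun x => ∑ j, ∑ l, ‖𝓕 (d.gsym t j l) x‖ ^ 2 :=
    funext (d.frobeniusNormSq_fderiv_u ht)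
  rw [heq]
  refine ⟨integrable_finsetSum _ fun j _ => integrable_finsetSum _ fun l _ => hF2 j l, ?_⟩
  rw [integral_finsetSum _ fun j _ => integrable_finsetSum _ fun l _ => hF2 j l]
  have hjl : ∀ j l, ∫ x, ‖𝓕 (d.gsym t j l) x‖ ^ 2 = 4 * π ^ 2 * ∫ ξ : EuclideanSpace ℝ ι, (ξ j) ^ 2 * ‖d.V t ξ l‖ ^ 2 := by
    intro j l
    obtain ⟨-, hg, hFg, hP⟩ := d.memLp_gsym ht j l
    rw [integral_norm_sq_eq_toReal hFg, hP, ← integral_norm_sq_eq_toReal hg, ← integral_const_mul]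
    exact integral_congr_ae (Eventually.of_forall fun ξ => d.norm_gsym_sq t j l ξ)
  simp_rw [integral_finsetSum _ fun l _ => hF2 _ l, hjl]
  rw [← integral_const_mul]
  have hI : ∀ j l, Integrable (fun ξ : EuclideanSpace ℝ ι => (ξ j) ^ 2 * ‖d.V t ξ l‖ ^ 2) volume := by
    intro j l
    have := (hg2 j l).const_mul (4 * π ^ 2)⁻¹
    refine this.congr (Eventually.of_forall fun ξ => ?_)
    simp only [d.norm_gsym_sq]
    have hπ : (4 * π ^ 2 : ℝ) ≠ 0 := by positivity
    field_simp
  have hrow : ∀ j, ∑ l, 4 * π ^ 2 * ∫ ξ : EuclideanSpace ℝ ι, (ξ j) ^ 2 * ‖d.V t ξ l‖ ^ 2 =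
      ∫ ξ : EuclideanSpace ℝ ι, 4 * π ^ 2 * ((ξ j) ^ 2 * ∑ l, ‖d.V t ξ l‖ ^ 2) := by
    intro j
    rw [integral_const_mul, ← Finset.mul_sum, ← integral_finsetSum _ fun l _ => hI j l]
    congr 1
    refine integral_congr_ae (Eventually.of_forall fun ξ => ?_)
    simp only [Finset.mul_sum]
  simp_rw [hrow]
  have hI' : ∀ j, Integrable (fun ξ : EuclideanSpace ℝ ι => 4 * π ^ 2 * ((ξ j) ^ 2 * ∑ l, ‖d.V t ξ l‖ ^ 2)) volume := by
    intro j
    have := (integrable_finsetSum (Finset.univ : Finset ι) fun l _ => hI j l).const_mul (4 * π ^ 2)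
    refine this.congr (Eventually.of_forall fun ξ => ?_)
    simp only [Finset.mul_sum]
  rw [← integral_finsetSum _ fun j _ => hI' j]
  refine integral_congr_ae (Eventually.of_forall fun ξ => ?_)
  simp only
  rw [← Finset.mul_sum, ← Finset.sum_mul, sum_sq_eq_norm_sq]

/-! ### The energy equality -/

/-- The Fourier-side dissipation `D(τ) = ∫ ‖ξ‖² ∑ₗ ‖V(τ,ξ)ₗ‖² dξ`. [folklore] -/
def D (τ : ℝ) : ℝ := ∫ ξ : EuclideanSpace ℝ ι, ‖ξ‖ ^ 2 * ∑ l, ‖d.V τ ξ l‖ ^ 2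

/-- `D ≥ 0`. [folklore] -/
theorem D_nonneg (τ : ℝ) : 0 ≤ d.D τ := integral_nonneg fun ξ => by positivity

/-- **`D` is integrable on bounded time intervals** (`D(τ) = -(2c)⁻¹ ∫ q(τ, ξ) dξ` and the product
integrability of the energy rate, `IsRegMild.integrable_erate_prod`). [folklore] -/
theorem integrableOn_D (s t : ℝ) : IntegrableOn d.D (Ioc s t) volume := by
  have h1 := ((d.mildK 1).integrable_erate_prod le_rfl s t).integral_prod_right
  have heq : ∀ τ, d.D τ = (-(2 * d.c))⁻¹ * ∫ ξ, IsRegMild.erate d.c d.m d.V τ ξ := by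
    intro τ
    rw [(d.mildK 1).integral_erate le_rfl τ, ← mul_assoc, inv_mul_cancel₀ (by have := d.c_pos; nlinarith : -(2 * d.c) ≠ 0),
      one_mul]
    rfl
  have : d.D = fun τ => (-(2 * d.c))⁻¹ * ∫ ξ, IsRegMild.erate d.c d.m d.V τ ξ := funext heq
  rw [this]
  exact h1.const_mul _

/-- **The space–time dissipation as a lower integral**: for `0 ≤ s ≤ t ≤ T`,
`∫⁻_{(s,t)} ∫⁻ |∇u|² = ofReal (4π² ∫ₛᵗ D)`; in particular it is finite. [folklore] -/
theorem lintegral_dissipation_eq {s t : ℝ} (hs : 0 ≤ s) (hst : s ≤ t) (ht : t ≤ d.T) :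
    ∫⁻ τ in Ioo s t, ∫⁻ x, ENNReal.ofReal (frobeniusNormSq (fderiv ℝ (d.u τ) x)) =
      ENNReal.ofReal (4 * π ^ 2 * ∫ τ in s..t, d.D τ) := by
  have hinner : ∀ τ ∈ Ioo s t, ∫⁻ x, ENNReal.ofReal (frobeniusNormSq (fderiv ℝ (d.u τ) x)) = ENNReal.ofReal (4 * π ^ 2 * d.D τ) := by
    intro τ hτ
    have hτI : τ ∈ Icc 0 d.T := ⟨hs.trans hτ.1.le, hτ.2.le.trans ht⟩
    obtain ⟨hi, he⟩ := d.integral_frobeniusNormSq_fderiv_u hτI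
    rw [← ofReal_integral_eq_lintegral_ofReal hi (Eventually.of_forall fun x => frobeniusNormSq_nonneg _), he]
    rfl
  rw [setLIntegral_congr_fun measurableSet_Ioo hinner]
  have hD : IntegrableOn (fun τ => 4 * π ^ 2 * d.D τ) (Ioo s t) volume :=
    ((d.integrableOn_D s t).mono_set Ioo_subset_Ioc_self).const_mul _
  rw [← ofReal_integral_eq_lintegral_ofReal hD (Eventually.of_forall fun τ => by have := d.D_nonneg τ; positivity),
    integral_const_mul, intervalIntegral.integral_of_le hst, integral_Ioc_eq_integral_Ioo]

/-- **Leray's energy equality for the regularised solution** (Leray 1934, (3.4) with §26;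
Ożański–Pooley 2018, (6.80)): for `0 ≤ s ≤ t ≤ T`,
`½‖u(t)‖₂² + ν ∫ₛᵗ ∫ |∇u|² = ½‖u(s)‖₂²`. [folklore] -/
theorem energyEq {s t : ℝ} (hs : 0 ≤ s) (hst : s ≤ t) (ht : t ≤ d.T) :
    VectorCalculus.kineticEnergy (d.u t) +
      d.ν * (∫⁻ τ in Ioo s t, ∫⁻ x, ENNReal.ofReal (frobeniusNormSq (fderiv ℝ (d.u τ) x))).toReal =
      VectorCalculus.kineticEnergy (d.u s) := by
  have htI : t ∈ Icc 0 d.T := ⟨hs.trans hst, ht⟩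
  have hsI : s ∈ Icc 0 d.T := ⟨hs, hst.trans ht⟩
  rw [d.lintegral_dissipation_eq hs hst ht, ENNReal.toReal_ofReal (mul_nonneg (by positivity)
    (intervalIntegral.integral_nonneg hst fun τ _ => d.D_nonneg τ)), d.kineticEnergy_u htI, d.kineticEnergy_u hsI]
  have hE := (d.mildK 1).energy_eq le_rfl hs hst ht
  have hc : d.c = 4 * π ^ 2 * d.ν := rfl
  rw [hc] at hE
  unfold D
  linear_combination (2⁻¹ : ℝ) * hE

/-- **Finiteness of the dissipation** on `(0, T')` for every `T' ≤ T`. [folklore] -/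
theorem lintegral_dissipation_lt_top {T' : ℝ} (hT' : T' ≤ d.T) :
    ∫⁻ τ in Ioo 0 T', ∫⁻ x, ENNReal.ofReal (frobeniusNormSq (fderiv ℝ (d.u τ) x)) < ⊤ := by
  rcases le_or_gt T' 0 with h | h
  · rw [Ioo_eq_empty (not_lt.2 h), Measure.restrict_empty, lintegral_zero_measure]; exact ENNReal.zero_lt_top
  · rw [d.lintegral_dissipation_eq le_rfl h.le hT']; exact ENNReal.ofReal_lt_top

end RegSetup

end Literature.Analysis.FluidPDE.FourierNS

end
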